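import Summits.BirchSwinnertonDyer.BirchSwinnertonDyer.Theses.EisensteinPrimes
import Summits.BirchSwinnertonDyer.Rank1Residual.X2.NonsplitCellCClassIntPNew
import Summits.BirchSwinnertonDyer.Rank1Residual.X2.NonsplitCellCClassInt
import Summits.BirchSwinnertonDyer.Rank1Residual.X2.SplitCellCClassIntEtale
import HarnessLib

/-!
# Crux 4 `BSDpOnCellC` from line b1's stubs with the non-split VALUE input needed ONLY AT `p = 3`
# — at `p ≥ 5` it is PUBLISHED (Castella JIMJ 2018 Thms. 2.10–2.11 in BDP 2013's display + the kernel
# rescaling of `X2/NonsplitBDPValueDisplayPNew.lean`) (cell `bsd-eis`, seat `bsd-eis-k5-c4`; route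
# `EisensteinPrimes`, crux 4 = stmt-BirchSwinnertonDyer-19034, line b1 skeleton v5; RULING L11 (O2))

HONEST FRAMING (cell `bsd-eis`): theorems only; nothing booked; X2 stays CONSTRUCTION-SHAPED; no label
moves; BSD is not proved by any of this — a closed crux 4 would close the B11 leaf of rung K5 only.

The registered skeleton v5 of crux 4 (cgshw g8, `Cruxes.BSDpOnCellC.B1.BSDpOnCellC_of`, sha16
6ef9525971332f26) composes FIVE stubs — `stub_publishedFacts` (23 registered Literature facts), `stub_c2`
(value half, both signs, wide receptacle), `stub_c3` (IMC atom, both signs), `stub_ctlOrSwitch` (split),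
`stub_mazurMC_cellB` (crux 3 verbatim) — into the route decl by a case split on the sign at `p`
(`X2.bsdp_of_cellC_of_split_of_intResiduals_of_ctlOrSwitch`, `X2.bsdp_of_cellC_of_not_split_of_intResiduals`).
This file proves the SAME composition with `stub_c2`'s non-split conjunct WEAKENED TO `p = 3`:
at a non-split `p ≥ 5` the value half is not an input — it is the PUBLISHED fact
`Castella2018Exceptional.thm210_thm211_bdpDisplay_pNew` (p435419; [cas-split] Thms. 2.10–2.11 at weight 2
in BDP 2013's own display, auxiliary data explicit) through the kernel theorems
`X2.continuousDisplay_pNew_of_bdpDisplay` (p436452: BDP display ⟹ continuous-function display with virtual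
periods; k5-c4-MEMO-1 (B2) in the kernel) and `X2.bsdp_of_cellC_of_not_split_of_pNewValue_of_imcInt`
(class level at `p ≥ 5`, one-sided value rigidity across periods + Hsieh 2014 Thm. 1).

* **`bsdpOnCellC_of_stubs_of_pNewValue`** — `BSDpOnCellC` from: the 23 published facts + the 24th
  (`thm210_thm211_bdpDisplay_pNew`); c2♭ `NonsplitBDPValueOnTreeInt W p` ONLY at `p = 3` (5 382 non-split
  B11 cells; no value theorem at `3 ‖ N` in print — LZZ18 modulo N1–N3, k5-c4-MEMO-1 (B3)); c2s♭ at every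
  split pair; `stub_c3`; `stub_ctlOrSwitch`; `MazurMCOnCellB` (crux 3). Case split: split → cgshw's
  class theorem; non-split `p ≥ 5` → k5-c4's; non-split `p = 3` (the only prime `2 < p < 5`) → the
  optimal-curve passage `X2.bsdp_of_cellC_of_forall_isIsogenous` + the pointwise
  `X2.bsdp_of_cellC_of_not_split_of_manin_of_intResiduals` at that `p` alone.

So in stub currency: crux 4 ⇐ PUB(24) ∧ [c2♭ at p = 3 ∧ ¬split] ∧ [c2s♭] ∧ c3 ∧ ctlOrSwitch ∧ crux 3.
CONDITIONAL on every listed binder; nothing booked; no label change.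

References: [Castella2018Exceptional] Thms. 2.10–2.11; [BertoliniDarmonPrasanna2013] Thm. 4.6, (5.1.11),
Thm. 5.5, §5.2; [Hsieh2014] Thm. 1; [KellerYin2024] Thm. D (PRE); [CastellaEtAl2021] Thm. 5.3.1;
[Mazur1978] Cor. 4.1; [Miller2011LMS] Def. 1.1.
-/

set_option autoImplicit false
set_option linter.dupNamespace false

noncomputable section

open scoped Classical MatrixGroups ModularForm

open CongruenceSubgroup WeierstrassCurve NumberField IsDedekindDomain Field PowerSeries
  Literature.NumberTheory.EllipticCurves Literature.NumberTheory.EllipticCurves.GreenbergSelmer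
  Literature.NumberTheory.EllipticCurves.ModularForms Literature.NumberTheory.QuadraticFields
  Literature.NumberTheory.EllipticCurves.Rank1Residual
  Literature.NumberTheory.EllipticCurves.Rank1Residual.Typed
  Literature.NumberTheory.EllipticCurves.KrizLi2019
  Literature.NumberTheory.EllipticCurves.GreenbergVatsal2000
  Literature.NumberTheory.EllipticCurves.Wuthrich2014
  Literature.NumberTheory.EllipticCurves.SteinWuthrich2013
  Literature.NumberTheory.EllipticCurves.Castella2018Exceptional
  Literature.NumberTheory.GaloisRepresentations Literature.NumberTheory.GaloisCohomology
  Literature.NumberTheory.Automorphic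
  Summit.BirchSwinnertonDyer.Rank1Residual.X11b.AcSelmer
  Summit.BirchSwinnertonDyer.Rank1Residual.X11b.Halves
  Summit.BirchSwinnertonDyer.Rank1Residual.X11b
  Summit.BirchSwinnertonDyer.Rank1Residual.X2

namespace Summit.BirchSwinnertonDyer.BirchSwinnertonDyer.Theorems

/-- **Crux 4 `BSDpOnCellC` from line b1's five stubs with the non-split value input ONLY AT `p = 3`.**
Hypotheses: the 23 published facts of `stub_publishedFacts` (as stated there) and the 24th,
`thm210_thm211_bdpDisplay_pNew` ([cas-split] Thms. 2.10–2.11 in BDP's display); `h2three` = c2♭ at the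
non-split pairs with `p = 3` ONLY; `h2s` = c2s♭ (split); `h3` = `stub_c3` verbatim; `hctl` =
`stub_ctlOrSwitch` verbatim; `hMCB` = the route decl `MazurMCOnCellB` (crux 3) verbatim. Conclusion: the
route decl `BSDpOnCellC` (= `X2.TargetC`) BY NAME. Proof: split → 
`X2.bsdp_of_cellC_of_split_of_intResiduals_of_ctlOrSwitch`; non-split with `5 ≤ p` →
`X2.bsdp_of_cellC_of_not_split_of_pNewValue_of_imcInt` (the value half FROM PRINT); non-split with `p < 5`
→ `p = 3` (`p` an odd prime), the Manin condition moved to the optimal curve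
(`X2.bsdp_of_cellC_of_forall_isIsogenous`, non-splitness is isogeny-invariant at a multiplicative prime)
and `X2.bsdp_of_cellC_of_not_split_of_manin_of_intResiduals` at that prime with `h2three`. CONDITIONAL on
every listed binder; nothing booked; X2 CONSTRUCTION-SHAPED; no label change.
[cite: Castella2018Exceptional, Thm. 2.10 and Thm. 2.11 (arXiv:1507.04260 pp. 13–14)]
[cite: Hsieh2014, Thm. 1 (arXiv:1112.1580 pp. 3–4)] [claim: KellerYin2024, status: under-review]
[cite: CastellaEtAl2021, Thm. 5.3.1] [cite: Mazur1978, Cor. 4.1] [cite: Miller2011LMS, Def. 1.1] -/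
theorem bsdpOnCellC_of_stubs_of_pNewValue
    (hPub : lambdaMu_multiplicative_of_gvPar ∧ thm16_charIdeal_dvd_multiplicative_of_reducible ∧
      thm61_splitMultiplicative ∧ thm61_nonsplitMultiplicative ∧
      exists_isSplitMultCanonical ∧ exists_isMultCanonical ∧ nonempty_modularParametrizationData ∧
      (∀ (W : WeierstrassCurve ℚ) [W.IsElliptic] [W.IsGloballyMinimal] (p : ℕ) [Fact p.Prime],
        greenberg_stevens (W := W) (p := p)) ∧
      exists_isNewformOf ∧
      (∀ (K : Type) [Field K] [NumberField K], poitouTate_selmerStructure_duality K) ∧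
      (∀ (K : Type) [Field K] [NumberField K], poitouTate_sha_tateDual K) ∧
      (∀ (K : Type) [Field K] [NumberField K] (v : HeightOneSpectrum (𝓞 K)),
        localEulerPoincareCharacteristic (v.adicCompletion K)) ∧
      fieldCdLE_two_of_numberField ∧
      (∀ (K : Type) [Field K] [NumberField K] (p : ℕ) [Fact p.Prime],
        ZpExtension.decomp_not_le_kerSubgroup_of_isAnticyclotomic K p) ∧
      hsieh2014_exists_anticyclotomicPAdicLFunction ∧
      (∀ (N : ℕ) [NeZero N] (W : WeierstrassCurve ℚ) (K : Type) [Field K] [NumberField K],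
        gross_zagier N W K) ∧
      (∀ (N : ℕ) [NeZero N] (W : WeierstrassCurve ℚ) (K : Type) [Field K] [NumberField K],
        kolyvagin N W K) ∧
      (∀ (N : ℕ) [NeZero N] (W : WeierstrassCurve ℚ) (K : Type) [Field K] [NumberField K],
        heegnerPointComplex_mem_range_map N W K) ∧
      rank_eq_analyticRank_of_analyticRank_le_one ∧ HoffsteinLuo1997_exists_twist_L_one_ne_zero ∧
      edixhoven_optimalManinConstant_integral ∧ mazur_not_dvd_maninConstant_of_odd ∧
      bsdRHS_eq_of_isIsogenous)
    (hCS : thm210_thm211_bdpDisplay_pNew)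
    (h2three : ∀ (W : WeierstrassCurve ℚ) [W.IsElliptic] [W.IsGloballyMinimal] (p : ℕ) [Fact p.Prime],
      p = 3 → CellC W p → ¬ W.HasSplitMultiplicativeReductionAtPrime p → NonsplitBDPValueOnTreeInt W p)
    (h2s : ∀ (W : WeierstrassCurve ℚ) [W.IsElliptic] [W.IsGloballyMinimal] (p : ℕ) [Fact p.Prime],
      CellC W p → W.HasSplitMultiplicativeReductionAtPrime p → SplitBDPValueOnTreeInt W p)
    (h3 : (∀ (W : WeierstrassCurve ℚ) [W.IsElliptic] [W.IsGloballyMinimal] (p : ℕ) [Fact p.Prime],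
        CellC W p → ¬ W.HasSplitMultiplicativeReductionAtPrime p → NonsplitIMCEqOnTreeInt W p) ∧
      (∀ (W : WeierstrassCurve ℚ) [W.IsElliptic] [W.IsGloballyMinimal] (p : ℕ) [Fact p.Prime],
        CellC W p → W.HasSplitMultiplicativeReductionAtPrime p → SplitIMCEqOnTreeInt W p))
    (hctl : ∀ (W : WeierstrassCurve ℚ) [W.IsElliptic] [W.IsGloballyMinimal] (p : ℕ) [Fact p.Prime],
      CellC W p → W.HasSplitMultiplicativeReductionAtPrime p →
        SplitControlOnTree W p ∨
          ∃ (W' : WeierstrassCurve ℚ) (_ : W'.IsElliptic) (_ : W'.IsGloballyMinimal),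
            IsIsogenous W W' ∧ HasPrimeToManinDatum W' p ∧
              ∀ Q₀ : (W'.baseChange ℚ_[p]).toAffine.Point, p • Q₀ = 0 → Q₀ = 0)
    (hMCB : Summit.BirchSwinnertonDyer.BirchSwinnertonDyer.Theses.EisensteinPrimes.MazurMCOnCellB) :
    Summit.BirchSwinnertonDyer.BirchSwinnertonDyer.Theses.EisensteinPrimes.BSDpOnCellC := by
  obtain ⟨hGV, hWu, hJs, hJn, hHs, hHn, hpar, hGS, hnf, hPT, hPT2, hEP, hcd, hBr, hH, hGZ, hKo, hHP,
    hGZK, hHL, hEd, hMaz, hCassels⟩ := hPub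
  obtain ⟨h3n, h3s⟩ := h3
  unfold Summit.BirchSwinnertonDyer.BirchSwinnertonDyer.Theses.EisensteinPrimes.MazurMCOnCellB at hMCB
  unfold Summit.BirchSwinnertonDyer.BirchSwinnertonDyer.Theses.EisensteinPrimes.BSDpOnCellC
  intro W _ _ p _ hc
  by_cases hs : W.HasSplitMultiplicativeReductionAtPrime p
  · -- the split sign (cgshw g8's class theorem, CTL ∨ étale switch)
    exact bsdp_of_cellC_of_split_of_intResiduals_of_ctlOrSwitch hGV hWu hJs hJn hHs hHn hpar hGS hnf hPT
      hPT2 hEP hcd hBr hH hGZ hKo hHP hGZK hHL hEd hMaz hCassels h2s h3s hctl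
      (fun W' _ _ p' _ hB _ ↦ hMCB W' p' hB) W p hc hs
  · by_cases hp5 : 5 ≤ p
    · -- non-split, `p ≥ 5`: the value half is PUBLISHED
      exact bsdp_of_cellC_of_not_split_of_pNewValue_of_imcInt hGV hWu hJs hJn hHs hHn hpar hGS hnf hPT
        hPT2 hEP hcd hBr hH hCS hGZ hKo hHP hGZK hHL hEd hMaz hCassels h3n
        (fun W' _ _ p' _ hB _ ↦ hMCB W' p' hB) W p hp5 hc hs
    · -- non-split, `p < 5`: `p` is an odd prime, so `p = 3`
      have hp : p.Prime := Fact.out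
      have hp2 : p ≠ 2 := hc.2.1
      have hp3 : p = 3 := by
        have h2le := hp.two_le
        interval_cases p
        · exact absurd rfl hp2
        · rfl
        · exact absurd hp (by decide)
      refine bsdp_of_cellC_of_forall_isIsogenous hEd hMaz hCassels hpar hnf hGZK W p hc ?_
      intro W₀ _ _ hiso hc₀ hMan₀
      have hns₀ : ¬ W₀.HasSplitMultiplicativeReductionAtPrime p := fun h ↦
        hs (IsogenyQuotientLine.hasSplitMultiplicativeReductionAtPrime_of_isIsogenous
          hiso.symm_of_charZero h)
      exact bsdp_of_cellC_of_not_split_of_manin_of_intResiduals W₀ p hGV hWu hJs hJn hHs hHn hpar hGS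
        hnf hPT hPT2 hEP hcd hBr hH hGZ hKo hHP hGZK hHL hc₀ hns₀ hMan₀ (h2three W₀ p hp3 hc₀ hns₀)
        (h3n W₀ p hc₀ hns₀) (fun W' _ _ hB _ ↦ hMCB W' p hB)

end Summit.BirchSwinnertonDyer.BirchSwinnertonDyer.Theorems

end
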